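import Mathlib.Analysis.SpecialFunctions.Trigonometric.Cotangent
import Mathlib.Analysis.SpecialFunctions.Trigonometric.DerivHyp
import Mathlib.Analysis.SpecialFunctions.ImproperIntegrals
import Mathlib.MeasureTheory.Integral.ExpDecay
import Mathlib.Analysis.SpecificLimits.Normed
import Literature.Analysis.SpecialFunctions.BesselJZeroFermiIntegral
import Literature.Analysis.SpecialFunctions.GammaProductBounds
import HarnessLib

/-!
# The cosine transform of `sech`: `∫₀^∞ cos(ωx)/cosh(bx) dx = (π/2b) sech(πω/2b)`

This file proves the classical self-reciprocity of the hyperbolic secant under the cosine transform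
(Gradshteyn–Ryzhik 3.981.3), for `b > 0` and real `ω`:

* `integral_cos_div_cosh`: `∫₀^∞ cos(ωx)/cosh(bx) dx = (π/(2b)) / cosh(πω/(2b))`;
* `integral_univ_cos_div_cosh`: `∫_ℝ cos(ωx)/cosh(bx) dx = (π/b) / cosh(πω/(2b))`, hence
  `integral_cos_div_cosh_pos`: it is positive.

## Proof

1. `tendsto_sum_sech` — **the Mittag-Leffler expansion of `sech`** from Mathlib's cotangent
   expansion (`cot_series_rep'`): with `1/sin θ = cot(θ/2) - cot θ` one gets the absolutely
   convergent `π/sin(πz) - 1/z = Σ_k [(1/(z-(2k+2)) + 1/(z+(2k+2))) - (1/(z-(2k+1)) + 1/(z+(2k+1)))]`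
   (`hasSum_inv_sin_sub_inv`, valid on `ℂ ∖ ℤ`); at `z = 1/2 + ti`, where `sin(πz) = cosh(πt)`,
   re-pairing the poles gives, with `a_n = n + 1/2`,
   `Σ_{k<K} [2a_{2k}/(a_{2k}² + t²) - 2a_{2k+1}/(a_{2k+1}² + t²)] → π/cosh(πt)`
   (the partial sums differ from those of the absolutely convergent form by `1/z - 1/(z + 2K)`).
2. `integral_cos_div_cosh` — expand `1/cosh(bx) = 2Σ_{n ≥ 0} (-1)ⁿ e^{-(2n+1)bx}` (`x > 0`); the
   partial sums are bounded by `4e^{-bx}` (alternating geometric sums,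
   `abs_alternating_geom_le`), so by dominated convergence and `∫₀^∞ e^{-cx} cos(ωx) dx =
   c/(c² + ω²)` (`integral_exp_neg_mul_cos`) the integral is the limit of
   `2Σ_{n<N} (-1)ⁿ (2n+1)b/((2n+1)²b² + ω²)`; along even `N` these are `(1/(2b))` times the partial
   sums of step 1 at `t = ω/(2b)`.

## Purpose

Lieb–Wu's operator `R̂ = K̂(1 + K̂²)⁻¹` (Physica A 321 (2003) 1, §5, proof of Theorem 1, eq. (R))
"has a Fourier transform `½ sech(ωU/4)`. The inverse Fourier transform is proportional to
`sech(2πx/U)`, which is positive." That positivity (here: `integral_cos_div_cosh_pos`, and the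
explicit closed form) is the second kernel input of the contraction argument recorded in the module
docstring of `Literature.MathematicalPhysics.QuantumLattice.LiebWuRho0Bounds`
(the first being `Literature.Analysis.SpecialFunctions.FermiKernelPositivity`).

## References

* G. E. Andrews, R. Askey, R. Roy, *Special Functions* (1999), §1.2 (1.2.5) (partial fractions of
  `π cot πz`; here turned into those of `1/sin` and `sech`).
* I. S. Gradshteyn, I. M. Ryzhik, *Table of Integrals, Series, and Products*, 3.981.3
  (`∫₀^∞ cos(ax)/cosh(βx) dx = (π/2β) sech(πa/2β)`).
* E. H. Lieb, F. Y. Wu, Physica A 321 (2003) 1–27 = arXiv:cond-mat/0207529, §5 (the operator `R̂`).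
-/

noncomputable section

open Filter Complex Real MeasureTheory Set
open scoped Topology

namespace Literature.Analysis.SpecialFunctions

/-- `1/2 + ti` is not an integer. [folklore] -/
theorem half_add_mul_I_mem_integerComplement (t : ℝ) : (1 / 2 : ℂ) + t * I ∈ Complex.integerComplement := by
  rw [Complex.mem_integerComplement_iff]
  rintro ⟨n, hn⟩
  have h := congrArg Complex.re hn
  simp at h
  have h2 : (2 * n : ℤ) = (1 : ℤ) := by
    have : (2 * n : ℝ) = 1 := by rw [h]; norm_num
    exact_mod_cast this
  omega

/-- `1/4 + (t/2)i` is not an integer. [folklore] -/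
theorem quarter_add_mul_I_mem_integerComplement (t : ℝ) : ((1 / 2 : ℂ) + t * I) / 2 ∈ Complex.integerComplement := by
  rw [Complex.mem_integerComplement_iff]
  rintro ⟨n, hn⟩
  have h := congrArg Complex.re hn
  simp at h
  have h2 : (4 * n : ℤ) = (1 : ℤ) := by
    have : (4 * n : ℝ) = 1 := by rw [h]; norm_num
    exact_mod_cast this
  omega

/-- Mathlib's cotangent expansion as a `HasSum`. [cite: AndrewsAskeyRoy1999, §1.2 (1.2.5)] -/
theorem hasSum_cot_sub_inv {z : ℂ} (hz : z ∈ Complex.integerComplement) :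
    HasSum (fun n : ℕ => 1 / (z - (n + 1)) + 1 / (z + (n + 1))) (π * Complex.cot (π * z) - 1 / z) := by
  rw [cot_series_rep' hz]
  exact (summable_cotTerm hz).hasSum

/-- `1/sin θ = cot(θ/2) - cot θ` (complex). [folklore] -/
theorem inv_sin_eq_cot_half_sub_cot {θ : ℂ} (hs : Complex.sin θ ≠ 0) (hs2 : Complex.sin (θ / 2) ≠ 0) :
    1 / Complex.sin θ = Complex.cot (θ / 2) - Complex.cot θ := by
  have hθ : θ = 2 * (θ / 2) := by ring
  have hsin : Complex.sin θ = 2 * Complex.sin (θ / 2) * Complex.cos (θ / 2) := by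
    conv_lhs => rw [hθ, Complex.sin_two_mul]
  have hcos : Complex.cos θ = 2 * Complex.cos (θ / 2) ^ 2 - 1 := by
    conv_lhs => rw [hθ, Complex.cos_two_mul]
  have hc2 : Complex.cos (θ / 2) ≠ 0 := by
    intro h; apply hs; rw [hsin, h, mul_zero]
  rw [Complex.cot, Complex.cot, hsin, hcos]
  field_simp
  ring

/-- **The Mittag-Leffler expansion of `π/sin(πz) - 1/z` in absolutely convergent form**:
`Σ_k [ (1/(z-(2k+2)) + 1/(z+(2k+2))) - (1/(z-(2k+1)) + 1/(z+(2k+1))) ] = π/sin(πz) - 1/z`.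
[cite: AndrewsAskeyRoy1999, §1.2 (1.2.5)] -/
theorem hasSum_inv_sin_sub_inv {z : ℂ} (hz : z ∈ Complex.integerComplement) (hz2 : z / 2 ∈ Complex.integerComplement) (hs : Complex.sin (π * z) ≠ 0)
    (hs2 : Complex.sin (π * z / 2) ≠ 0) :
    HasSum (fun k : ℕ => (1 / (z - (2 * k + 2)) + 1 / (z + (2 * k + 2))) -
      (1 / (z - (2 * k + 1)) + 1 / (z + (2 * k + 1)))) (π / Complex.sin (π * z) - 1 / z) := by
  set f : ℕ → ℂ := fun n => 1 / (z - (n + 1)) + 1 / (z + (n + 1)) with hf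
  have h1 : HasSum f (π * Complex.cot (π * z) - 1 / z) := hasSum_cot_sub_inv hz
  have h2 := hasSum_cot_sub_inv hz2
  -- the expansion at `z/2` is twice the odd part of the expansion at `z`
  have h2' : HasSum (fun k : ℕ => 2 * f (2 * k + 1)) (π * Complex.cot (π * (z / 2)) - 1 / (z / 2)) := by
    refine h2.congr_fun fun k => ?_
    simp only [hf]
    push_cast
    have e1 : z / 2 - (k + 1) = (z - (2 * k + 1 + 1)) / 2 := by ring
    have e2 : z / 2 + (k + 1) = (z + (2 * k + 1 + 1)) / 2 := by ring
    rw [e1, e2]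
    field_simp
  have hsf : Summable f := h1.summable
  have he : Summable fun k : ℕ => f (2 * k) := hsf.comp_injective (fun a b h => by simpa using h)
  have ho : Summable fun k : ℕ => f (2 * k + 1) := hsf.comp_injective (fun a b h => by simpa using h)
  have hsplit := tsum_even_add_odd he ho
  rw [h1.tsum_eq] at hsplit
  have ho' : ∑' k, f (2 * k + 1) = (π * Complex.cot (π * (z / 2)) - 1 / (z / 2)) / 2 := by
    have := h2'.tsum_eq
    rw [tsum_mul_left] at this
    rw [← this]; ring
  have key : HasSum (fun k : ℕ => f (2 * k + 1) - f (2 * k)) (∑' k, f (2 * k + 1) - ∑' k, f (2 * k)) :=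
    ho.hasSum.sub he.hasSum
  have hval : ∑' k, f (2 * k + 1) - ∑' k, f (2 * k) = π / Complex.sin (π * z) - 1 / z := by
    have e : ∑' k, f (2 * k) = π * Complex.cot (π * z) - 1 / z - ∑' k, f (2 * k + 1) := by
      rw [← hsplit]; ring
    have hid := inv_sin_eq_cot_half_sub_cot hs hs2
    rw [e, ho', div_eq_mul_one_div (π : ℂ) (Complex.sin _), hid,
      show (π : ℂ) * z / 2 = π * (z / 2) by ring]
    have hz0 : z ≠ 0 := Complex.integerComplement.ne_zero hz
    field_simp
    ring
  rw [hval] at key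
  refine key.congr_fun fun k => ?_
  simp only [hf]
  push_cast
  ring_nf

/-- At `z = 1/2 + ti`: `sin(πz) = cosh(πt)`. [folklore] -/
theorem sin_pi_mul_half_add_mul_I (t : ℝ) :
    Complex.sin (π * ((1 / 2 : ℂ) + t * I)) = (Real.cosh (π * t) : ℂ) := by
  rw [mul_add, show (π : ℂ) * (1 / 2) = π / 2 by ring, Complex.sin_add, Complex.sin_pi_div_two,
    Complex.cos_pi_div_two, one_mul, zero_mul, add_zero, show (π : ℂ) * (t * I) = (π * t) * I by ring,
    Complex.cos_mul_I, Complex.ofReal_cosh]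
  push_cast
  ring_nf




/-- The real Cauchy profile as a difference of two complex poles: for `a, t` real,
`2a/(a² + t²) = 1/(a + ti) + 1/(a - ti)`. [folklore] -/
theorem ofReal_two_mul_div_sq_add_sq (a t : ℝ) (ha : a ≠ 0 ∨ t ≠ 0) :
    ((2 * a / (a ^ 2 + t ^ 2) : ℝ) : ℂ) = 1 / ((a : ℂ) + t * I) + 1 / ((a : ℂ) - t * I) := by
  have hpos : (a : ℂ) ^ 2 + (t : ℂ) ^ 2 ≠ 0 := by
    have : (0 : ℝ) < a ^ 2 + t ^ 2 := by
      rcases ha with ha | ht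
      · positivity
      · positivity
    exact_mod_cast this.ne'
  have h1 : (a : ℂ) + t * I ≠ 0 := by
    intro h
    have hre := congrArg Complex.re h
    have him := congrArg Complex.im h
    simp at hre him
    rcases ha with ha | ht <;> [exact ha hre; exact ht him]
  have h2 : (a : ℂ) - t * I ≠ 0 := by
    intro h
    have hre := congrArg Complex.re h
    have him := congrArg Complex.im h
    simp at hre him
    rcases ha with ha | ht <;> [exact ha hre; exact ht him]
  have hprod : ((a : ℂ) + t * I) * ((a : ℂ) - t * I) = (a : ℂ) ^ 2 + (t : ℂ) ^ 2 := by
    ring_nf; rw [Complex.I_sq]; ring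
  push_cast
  rw [div_add_div _ _ h1 h2, hprod]
  congr 1
  ring

/-- **Partial sums of the Mittag-Leffler expansion of `sech`**: with `a_n = n + 1/2`,
`Σ_{k<K} [2a_{2k}/(a_{2k}² + t²) - 2a_{2k+1}/(a_{2k+1}² + t²)] → π / cosh(πt)`.
[cite: AndrewsAskeyRoy1999, §1.2 (1.2.5)] -/
theorem tendsto_sum_sech (t : ℝ) :
    Tendsto (fun K : ℕ => ∑ k ∈ Finset.range K,
      (2 * (2 * k + 1 / 2) / ((2 * k + 1 / 2) ^ 2 + t ^ 2) -
        2 * (2 * k + 3 / 2) / ((2 * k + 3 / 2) ^ 2 + t ^ 2))) atTop (𝓝 (π / Real.cosh (π * t))) := by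
  set z : ℂ := (1 / 2 : ℂ) + t * I with hzdef
  have hz : z ∈ Complex.integerComplement := half_add_mul_I_mem_integerComplement t
  have hz2 : z / 2 ∈ Complex.integerComplement := quarter_add_mul_I_mem_integerComplement t
  have hsin : Complex.sin (π * z) = (Real.cosh (π * t) : ℂ) := sin_pi_mul_half_add_mul_I t
  have hs : Complex.sin (π * z) ≠ 0 := by
    rw [hsin]; exact_mod_cast (Real.cosh_pos _).ne'
  have hs2 : Complex.sin (π * z / 2) ≠ 0 := by
    intro h0
    rw [Complex.sin_eq_zero_iff] at h0
    obtain ⟨k, hk⟩ := h0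
    apply (Complex.mem_integerComplement_iff.1 hz2)
    refine ⟨k, ?_⟩
    have hπ : (π : ℂ) ≠ 0 := by exact_mod_cast Real.pi_ne_zero
    field_simp at hk
    rw [hk]
    ring
  have hc := hasSum_inv_sin_sub_inv hz hz2 hs hs2
  -- complex partial sums: `Σ_{k<K} q_k = (1/z - 1/(z + 2K)) + Σ_{k<K} c_k`
  have hne : ∀ m : ℕ, z + m ≠ 0 := fun m => by
    exact_mod_cast Complex.integerComplement_add_ne_zero hz (m : ℤ)
  have hne' : ∀ m : ℕ, z - m ≠ 0 := fun m => by
    have := Complex.integerComplement_add_ne_zero hz (-(m : ℤ))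
    simpa [sub_eq_add_neg] using this
  have hterm : ∀ k : ℕ, ((2 * (2 * k + 1 / 2) / ((2 * k + 1 / 2) ^ 2 + t ^ 2) -
      2 * (2 * k + 3 / 2) / ((2 * k + 3 / 2) ^ 2 + t ^ 2) : ℝ) : ℂ) =
      ((1 / (z - (2 * k + 2)) + 1 / (z + (2 * k + 2))) - (1 / (z - (2 * k + 1)) + 1 / (z + (2 * k + 1))))
        + (1 / (z + 2 * k) - 1 / (z + (2 * k + 2))) := by
    intro k
    have e1 := ofReal_two_mul_div_sq_add_sq (2 * k + 1 / 2) t (Or.inl (by positivity))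
    have e2 := ofReal_two_mul_div_sq_add_sq (2 * k + 3 / 2) t (Or.inl (by positivity))
    push_cast at e1 e2 ⊢
    rw [e1, e2]
    have f1 : (2 * (k : ℂ) + 1 / 2) + t * I = z + 2 * k := by rw [hzdef]; ring
    have f2 : (2 * (k : ℂ) + 1 / 2) - t * I = -(z - (2 * k + 1)) := by rw [hzdef]; ring
    have f3 : (2 * (k : ℂ) + 3 / 2) + t * I = z + (2 * k + 1) := by rw [hzdef]; ring
    have f4 : (2 * (k : ℂ) + 3 / 2) - t * I = -(z - (2 * k + 2)) := by rw [hzdef]; ring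
    rw [f1, f2, f3, f4]
    simp only [one_div, inv_neg]
    ring
  have hsumC : ∀ K : ℕ, ∑ k ∈ Finset.range K, (((2 * (2 * k + 1 / 2) / ((2 * k + 1 / 2) ^ 2 + t ^ 2) -
      2 * (2 * k + 3 / 2) / ((2 * k + 3 / 2) ^ 2 + t ^ 2) : ℝ) : ℂ)) =
      (1 / z - 1 / (z + 2 * K)) + ∑ k ∈ Finset.range K,
        ((1 / (z - (2 * k + 2)) + 1 / (z + (2 * k + 2))) - (1 / (z - (2 * k + 1)) + 1 / (z + (2 * k + 1)))) := by
    intro K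
    induction K with
    | zero => simp
    | succ K ih =>
      rw [Finset.sum_range_succ, Finset.sum_range_succ, ih, hterm]
      push_cast
      ring
  -- limits
  have hlimC : Tendsto (fun K : ℕ => ∑ k ∈ Finset.range K, (((2 * (2 * k + 1 / 2) /
      ((2 * k + 1 / 2) ^ 2 + t ^ 2) - 2 * (2 * k + 3 / 2) / ((2 * k + 3 / 2) ^ 2 + t ^ 2) : ℝ) : ℂ)))
      atTop (𝓝 ((π : ℂ) / Complex.sin (π * z))) := by
    simp_rw [hsumC]
    have h1 : Tendsto (fun K : ℕ => 1 / z - 1 / (z + 2 * K)) atTop (𝓝 (1 / z - 0)) := by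
      refine tendsto_const_nhds.sub ?_
      have hnorm : Tendsto (fun K : ℕ => ‖z + 2 * (K : ℂ)‖) atTop atTop := by
        have hre : ∀ K : ℕ, (2 * (K : ℝ) + 1 / 2) ≤ ‖z + 2 * (K : ℂ)‖ := fun K => by
          have : (z + 2 * (K : ℂ)).re = 2 * K + 1 / 2 := by simp [hzdef]; ring
          calc (2 * (K : ℝ) + 1 / 2) = |(z + 2 * (K : ℂ)).re| := by rw [this, abs_of_pos (by positivity)]
            _ ≤ ‖z + 2 * (K : ℂ)‖ := Complex.abs_re_le_norm _
        refine tendsto_atTop_mono hre ?_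
        refine tendsto_atTop_add_const_right _ _ ?_
        exact (tendsto_natCast_atTop_atTop (R := ℝ)).const_mul_atTop two_pos
      have := hnorm.inv_tendsto_atTop
      rw [tendsto_zero_iff_norm_tendsto_zero]
      refine this.congr fun K => ?_
      simp [norm_inv]
    rw [sub_zero] at h1
    have h2 := hc.tendsto_sum_nat
    have := h1.add h2
    convert this using 2
    ring
  -- back to the reals
  rw [hsin, ← Complex.ofReal_div] at hlimC
  have := (Complex.continuous_re.tendsto _).comp hlimC
  simp only [Complex.ofReal_re] at this
  refine this.congr fun K => ?_
  simp only [Function.comp_apply, Complex.re_sum, Complex.ofReal_re]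




/-! ### The cosine transform of `sech` -/

/-- Partial sums of `1/cosh(bx) = 2 Σ (-1)ⁿ e^{-(2n+1)bx}` in terms of the alternating geometric sums:
`2 Σ_{n<N} (-1)ⁿ e^{-(2n+1)bx} = 2 e^{bx} Σ_{n<N} (-1)ⁿ q^{n+1}`, `q = e^{-2bx}`. [folklore] -/
theorem sech_partial_sum_eq (b x : ℝ) (N : ℕ) :
    2 * ∑ n ∈ Finset.range N, (-1 : ℝ) ^ n * Real.exp (-((2 * n + 1) * b * x)) =
      2 * Real.exp (b * x) * ∑ n ∈ Finset.range N, (-1 : ℝ) ^ n * Real.exp (-(2 * b * x)) ^ (n + 1) := by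
  rw [Finset.mul_sum, Finset.mul_sum]
  refine Finset.sum_congr rfl fun n _ => ?_
  have : Real.exp (-((2 * n + 1) * b * x)) = Real.exp (b * x) * Real.exp (-(2 * b * x)) ^ (n + 1) := by
    rw [← Real.exp_nat_mul, ← Real.exp_add]
    congr 1
    push_cast
    ring
  rw [this]
  ring

/-- `2 e^{-bx}/(1 + e^{-2bx}) = 1/cosh(bx)`. [folklore] -/
theorem two_mul_exp_mul_div_eq_inv_cosh (b x : ℝ) : 2 * Real.exp (b * x) * (Real.exp (-(2 * b * x)) / (1 + Real.exp (-(2 * b * x)))) =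
    1 / Real.cosh (b * x) := by
  rw [Real.cosh_eq]
  have h1 : Real.exp (-(2 * b * x)) = (Real.exp (b * x))⁻¹ ^ 2 := by
    rw [← Real.exp_neg, ← Real.exp_nat_mul]; congr 1; push_cast; ring
  have h2 : Real.exp (-(b * x)) = (Real.exp (b * x))⁻¹ := Real.exp_neg _
  rw [h1, h2]
  have hE := Real.exp_pos (b * x)
  field_simp

/-- **The half-line cosine transform of `sech`**: for `b > 0` and real `ω`,
`∫₀^∞ cos(ωx)/cosh(bx) dx = (π/(2b)) / cosh(πω/(2b))`. [folklore] -/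
theorem integral_cos_div_cosh {b : ℝ} (hb : 0 < b) (ω : ℝ) :
    ∫ x in Ioi (0 : ℝ), Real.cos (ω * x) / Real.cosh (b * x) = π / (2 * b) / Real.cosh (π * ω / (2 * b)) := by
  -- the partial sums of the integrands
  set F : ℕ → ℝ → ℝ := fun N x => Real.cos (ω * x) *
    (2 * ∑ n ∈ Finset.range N, (-1 : ℝ) ^ n * Real.exp (-((2 * n + 1) * b * x))) with hF
  -- their integrals
  have hint : ∀ N, ∫ x in Ioi (0 : ℝ), F N x =
      2 * ∑ n ∈ Finset.range N, (-1 : ℝ) ^ n * ((2 * n + 1) * b / (((2 * n + 1) * b) ^ 2 + ω ^ 2)) := by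
    intro N
    have e : (fun x => F N x) = fun x => ∑ n ∈ Finset.range N,
        (2 * (-1 : ℝ) ^ n) * (Real.exp (-((2 * n + 1) * b * x)) * Real.cos (ω * x)) := by
      funext x; simp only [hF, Finset.mul_sum]; refine Finset.sum_congr rfl fun n _ => ?_; ring
    rw [e, MeasureTheory.integral_finsetSum]
    · rw [Finset.mul_sum]
      refine Finset.sum_congr rfl fun n _ => ?_
      rw [MeasureTheory.integral_const_mul, integral_exp_neg_mul_cos (by positivity) ω]
      ring
    · intro n _
      refine (Integrable.mono' (exp_neg_integrableOn_Ioi 0 (by positivity : (0:ℝ) < (2 * n + 1) * b))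
        (by fun_prop : Continuous fun x => Real.exp (-((2 * n + 1) * b * x)) * Real.cos (ω * x)).aestronglyMeasurable
        (Eventually.of_forall fun x => ?_)).const_mul _
      rw [Real.norm_eq_abs, abs_mul, Real.abs_exp, neg_mul]
      exact mul_le_of_le_one_right (Real.exp_pos _).le (Real.abs_cos_le_one _)
  -- dominated convergence
  have hlim := tendsto_integral_of_dominated_convergence (fun x => 4 * Real.exp (-(b * x)))
    (μ := volume.restrict (Ioi (0 : ℝ))) (F := F)
    (f := fun x => Real.cos (ω * x) / Real.cosh (b * x)) ?_ ?_ ?_ ?_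
  rotate_left
  · intro N
    exact (by simp only [hF]; fun_prop : Continuous (F N)).aestronglyMeasurable
  · exact ((exp_neg_integrableOn_Ioi 0 hb).const_mul 4).congr
      (Eventually.of_forall fun x => by simp [neg_mul])
  · intro N
    filter_upwards [ae_restrict_mem measurableSet_Ioi] with x hx
    have hx : (0 : ℝ) < x := hx
    set q := Real.exp (-(2 * b * x)) with hq
    have hq0 : 0 ≤ q := (Real.exp_pos _).le
    have hq1 : q ≤ 1 := by
      rw [hq, Real.exp_le_one_iff]; have := mul_pos hb hx; linarith
    simp only [hF]
    rw [sech_partial_sum_eq, Real.norm_eq_abs, abs_mul, abs_mul, abs_mul, Real.abs_exp,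
      abs_of_pos (by norm_num : (0:ℝ) < 2)]
    have h1 := Real.abs_cos_le_one (ω * x)
    have h3 := abs_alternating_geom_le hq0 hq1 N
    have hE := Real.exp_pos (b * x)
    calc |Real.cos (ω * x)| * (2 * Real.exp (b * x) * |∑ n ∈ Finset.range N, (-1 : ℝ) ^ n * q ^ (n + 1)|)
        ≤ 1 * (2 * Real.exp (b * x) * (2 * q)) := by gcongr
      _ = 4 * Real.exp (-(b * x)) := by
          rw [hq, show -(2 * b * x) = -(b * x) + -(b * x) by ring, Real.exp_add, Real.exp_neg]
          field_simp
          ring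
  · filter_upwards [ae_restrict_mem measurableSet_Ioi] with x hx
    have hx : (0 : ℝ) < x := hx
    have hq0 : 0 ≤ Real.exp (-(2 * b * x)) := (Real.exp_pos _).le
    have hq1 : Real.exp (-(2 * b * x)) < 1 := by
      rw [Real.exp_lt_one_iff]; have := mul_pos hb hx; linarith
    simp only [hF]
    simp_rw [sech_partial_sum_eq]
    have := ((tendsto_alternating_geom hq0 hq1).const_mul (2 * Real.exp (b * x))).const_mul (Real.cos (ω * x))
    rw [two_mul_exp_mul_div_eq_inv_cosh] at this
    rw [div_eq_mul_one_div]
    exact this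
  -- the value along even `N`
  simp_rw [hint] at hlim
  have h2 : Tendsto (fun K : ℕ => 2 * K) atTop atTop :=
    tendsto_atTop_mono (fun K => by show K ≤ 2 * K; omega) tendsto_id
  have heven := hlim.comp h2
  have hpair : ∀ K : ℕ, 2 * ∑ n ∈ Finset.range (2 * K), (-1 : ℝ) ^ n * ((2 * n + 1) * b / (((2 * n + 1) * b) ^ 2 + ω ^ 2)) =
      1 / (2 * b) * ∑ k ∈ Finset.range K, (2 * (2 * k + 1 / 2) / ((2 * k + 1 / 2) ^ 2 + (ω / (2 * b)) ^ 2) -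
        2 * (2 * k + 3 / 2) / ((2 * k + 3 / 2) ^ 2 + (ω / (2 * b)) ^ 2)) := by
    intro K
    induction K with
    | zero => simp
    | succ K ih =>
      rw [show 2 * (K + 1) = 2 * K + 1 + 1 by ring, Finset.sum_range_succ, Finset.sum_range_succ, mul_add,
        mul_add, ih, Finset.sum_range_succ, mul_add]
      have e1 : (-1 : ℝ) ^ (2 * K) = 1 := by rw [pow_mul]; simp
      have e2 : (-1 : ℝ) ^ (2 * K + 1) = -1 := by rw [pow_succ, e1]; simp
      rw [e1, e2]
      have hb0 : b ≠ 0 := hb.ne'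
      push_cast
      field_simp
      ring
  have heven' : Tendsto (fun K : ℕ => 1 / (2 * b) * ∑ k ∈ Finset.range K,
      (2 * (2 * k + 1 / 2) / ((2 * k + 1 / 2) ^ 2 + (ω / (2 * b)) ^ 2) -
        2 * (2 * k + 3 / 2) / ((2 * k + 3 / 2) ^ 2 + (ω / (2 * b)) ^ 2))) atTop
      (𝓝 (∫ x in Ioi (0 : ℝ), Real.cos (ω * x) / Real.cosh (b * x))) := by
    refine heven.congr fun K => ?_
    simp only [Function.comp_apply]
    exact hpair K
  have hval := (tendsto_sum_sech (ω / (2 * b))).const_mul (1 / (2 * b))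
  have := tendsto_nhds_unique heven' hval
  rw [this]
  have : π * (ω / (2 * b)) = π * ω / (2 * b) := by ring
  rw [this]
  ring




/-- **The cosine transform of `sech` on the line**: `∫_ℝ cos(ωx)/cosh(bx) dx = (π/b)/cosh(πω/(2b))`
(`b > 0`). [folklore] -/
theorem integral_univ_cos_div_cosh {b : ℝ} (hb : 0 < b) (ω : ℝ) :
    ∫ x : ℝ, Real.cos (ω * x) / Real.cosh (b * x) = π / b / Real.cosh (π * ω / (2 * b)) := by
  set A : ℝ → ℝ := fun x => Real.cos (ω * x) / Real.cosh (b * x) with hA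
  have hAc : Continuous A := by
    simp only [hA]
    exact Continuous.div (by fun_prop) (by fun_prop) fun x => (Real.cosh_pos _).ne'
  have hbound : ∀ x, ‖A x‖ ≤ 2 * Real.exp (-(b * |x|)) := by
    intro x
    simp only [hA, Real.norm_eq_abs, abs_div, abs_of_pos (Real.cosh_pos _)]
    rw [div_le_iff₀ (Real.cosh_pos _)]
    have h1 := Real.abs_cos_le_one (ω * x)
    have h2 : 1 ≤ 2 * Real.exp (-(b * |x|)) * Real.cosh (b * x) := by
      rw [← Real.cosh_abs, abs_mul, abs_of_pos hb, Real.cosh_eq]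
      have hE := Real.exp_pos (b * |x|)
      have hprod : Real.exp (-(b * |x|)) * Real.exp (b * |x|) = 1 := by rw [← Real.exp_add]; simp
      nlinarith [Real.exp_pos (-(b * |x|)), sq_nonneg (Real.exp (-(b * |x|)))]
    linarith
  have hAi : Integrable A := by
    refine Integrable.mono' ((integrable_exp_neg_mul_abs hb).const_mul 2)
      hAc.aestronglyMeasurable (Eventually.of_forall hbound)
  have hsplit := integral_add_compl (measurableSet_Ioi (a := (0 : ℝ))) hAi
  rw [← hsplit, compl_Ioi]
  have hneg : ∫ x in Iic (0:ℝ), A x = ∫ x in Ioi (0:ℝ), A x := by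
    rw [← neg_zero, ← integral_comp_neg_Ioi (f := A)]
    simp only [neg_zero]
    refine setIntegral_congr_fun measurableSet_Ioi fun x _ => ?_
    simp only [hA, mul_neg, Real.cos_neg, Real.cosh_neg]
  rw [hneg, ← two_mul]
  simp only [hA]
  rw [integral_cos_div_cosh hb ω]
  field_simp

/-- **Positivity of the `sech` kernel**: `∫_ℝ cos(ωx)/cosh(bx) dx > 0` — the inverse Fourier
transform of `sech` is positive (it is again a `sech`). [folklore] -/
theorem integral_cos_div_cosh_pos {b : ℝ} (hb : 0 < b) (ω : ℝ) :
    0 < ∫ x : ℝ, Real.cos (ω * x) / Real.cosh (b * x) := by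
  rw [integral_univ_cos_div_cosh hb]
  have := Real.cosh_pos (π * ω / (2 * b))
  positivity

end Literature.Analysis.SpecialFunctions
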